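import Summits.HubbardSuperconductivity.HubbardSuperconductivity.Theorems.AnisotropyChordStiffnessWindow
import Summits.HubbardSuperconductivity.HubbardSuperconductivity.Theorems.AnisotropyChordInsertionEntropyReduction
import Literature.MathematicalPhysics.QuantumLattice.LiebRobinsonHastingsKomaSpectralProofs

/-!
# Route `AnisotropyChord` / H0 rotor rung: the infrared input in STIFFNESS currency — typed hypotheses
# (S_Ω), (S_Ω^γ), (S), (S_tw), the first lemma L1 and the target THEOREM TWIST-IR, with the PROVED links
# `(S_Ω) ⇒ (IR₁)`, `(S_Ω^γ) ⇒ (IR_{2−γ})`, `TWIST-IR ⇒ ((S_tw) ⇒ (IR_α))` and the assembly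
# `TWIST-IR ⇒ (S_tw) ∧ H1 ∧ (S ≤ S_max) ⇒ BEC` (theory seat cycle 8, memo ROTOR-THEORY-8 §103–§107;
# Sketch8 Parts B, D–G ported — PORT-SPEC P-10)

Typing authority: theory seat `hubbard-h0-rotor-theory-1`, cycle 8 (2026-08-28).  Nothing here claims the
hypotheses; the links are proved from THEOREM IR-S (`AnisotropyChordStiffnessWindow`) and the entropy-route
reduction (`AnisotropyChordInsertionEntropyReduction`, `eventualCondensate_of_onebody_infrared`).

* operators: `densityModeOp` (`ρ_k`), `hcbHamiltonian`, `currentDiv` (`D_k = [H, ρ_k]`), `toC`,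
  `bondCurrent`, `currentMode` (`Jⁱ_k`), `kineticOp` (`−Tᵢ`); `IsOrthonormalFamily`;
* hypotheses: `ScaleResolvedStiffness` (S_Ω), `ScaleResolvedStiffnessExp` (S_Ω^γ),
  `UniformTransverseStiffness` (S — the director's «uniform transverse stiffness», variational form),
  `UniformTwistStiffness` (S_tw); first lemma `FilteredLocalityIdentity` (L1, Hastings–Koma filtered
  spectral identity); target `TwistStiffnessInfrared` (THEOREM TWIST-IR, memo §107, proof sketch);
* links (proved): `infraredStructureBound_of_scaleResolvedStiffness`,
  `infraredStructureBound_of_scaleResolvedStiffnessExp`, `infraredStructureBound_of_uniformTwistStiffness`,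
  **`eventualCondensate_of_uniformTwistStiffness`** (H0 in the rotor class assembled modulo TWIST-IR and H1).
-/

set_option linter.dupNamespace false

noncomputable section

open Matrix Complex Finset Filter Topology MeasureTheory
open scoped ComplexConjugate Real
open Literature.MathematicalPhysics.QuantumLattice hiding torusPhase torusNorm
open Literature.Probability.LatticeModels
open Summit.HubbardSuperconductivity.HubbardSuperconductivity.Theorems.AnisotropyChord.InsertionEntropy

namespace Summit.HubbardSuperconductivity.HubbardSuperconductivity.Theorems.AnisotropyChord.Stiffness

/-! ## Operators (Sketch8 Part B) -/

/-- Orthonormality of a family of vectors `n → ℂ` in `dotProduct` currency: `vᵢ† vⱼ = δᵢⱼ`. [folklore] -/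
def IsOrthonormalFamily {n ι : Type*} [Fintype n] [DecidableEq ι] (v : ι → n → ℂ) : Prop :=
  ∀ i j, star (v i) ⬝ᵥ v j = if i = j then (1 : ℂ) else 0

variable (L : ℕ) [NeZero L]

/-- The density mode `ρ_k = Σ_s e^{2πi k·s/L} n_s` as a diagonal operator (eigenvalue
`Σ_{s : σ s = 0} e^{2πi k·s/L}` on the configuration `σ`; occupied ⇔ `σ s = 0`, as in `structureFactor`). [folklore] -/
def densityModeOp (k : TorusSite 2 L) : Op (TorusSite 2 L) 2 :=
  Matrix.diagonal (fun σ : TensorIndex (TorusSite 2 L) 2 => ∑ s, if σ s = 0 then torusPhase L k s else 0)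

/-- Hard-core bosons on the `L × L` torus with nearest-neighbour hopping `½` and neighbour coupling `Δ`
= the tree's spin-½ XXZ Hamiltonian `−Σ_e (SˣSˣ + SʸSʸ + Δ SᶻSᶻ)`. [folklore] -/
abbrev hcbHamiltonian (Δ : ℝ) : Op (TorusSite 2 L) 2 :=
  xxzHamiltonian 1 (torusGraph 2 L) (-1) Δ

/-- The CURRENT DIVERGENCE operator `D_k := [H, ρ_k]` (lattice continuity equation
`D_k = Σᵢ (1 − e^{2πi kᵢ/L}) Jⁱ_k`; only the commutator form is used). Memo ROTOR-THEORY-8 §103 (i). [folklore] -/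
def currentDiv (Δ : ℝ) (k : TorusSite 2 L) : Op (TorusSite 2 L) 2 :=
  hcbHamiltonian L Δ * densityModeOp L k - densityModeOp L k * hcbHamiltonian L Δ

/-- Real amplitudes viewed as complex vectors. [folklore] -/
def toC (a : TensorIndex (TorusSite 2 L) 2 → ℝ) : TensorIndex (TorusSite 2 L) 2 → ℂ :=
  fun σ => (a σ : ℂ)

/-- Bond current `j_{xy} = −i (Sˣ_x Sʸ_y − Sʸ_x Sˣ_y)` (`[H, n_x] = Σ_{y ∼ x} j_{xy}`, memo §103 (i)). [folklore] -/
def bondCurrent (x y : TorusSite 2 L) : Op (TorusSite 2 L) 2 :=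
  (-Complex.I) • (siteSpin 1 x 0 * siteSpin 1 y 1 - siteSpin 1 x 1 * siteSpin 1 y 0)

/-- Current mode in lattice direction `i`: `Jⁱ_k = Σ_x e^{2πi k·x/L} j_{x,x+eᵢ}`. [folklore] -/
def currentMode (k : TorusSite 2 L) (i : Fin 2) : Op (TorusSite 2 L) 2 :=
  ∑ x : TorusSite 2 L, torusPhase L k x • bondCurrent L x (x + Pi.single i 1)

/-- Kinetic operator of direction `i`: `−Tᵢ = Σ_x (Sˣ_x Sˣ_{x+eᵢ} + Sʸ_x Sʸ_{x+eᵢ})`; its expectation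
`⟨−Tᵢ⟩ = tᵢ |Λ|` is the f-sum / total current-susceptibility constant (gauge identity, memo §103 (iii)). [folklore] -/
def kineticOp (i : Fin 2) : Op (TorusSite 2 L) 2 :=
  ∑ x : TorusSite 2 L, (spinBond 1 0 x (x + Pi.single i 1) + spinBond 1 1 x (x + Pi.single i 1))

/-- THEOREM IR-S for the named operators: `Σ_{i∈s} |vᵢ† D_k a|²/(λᵢ − E) ≤ Ω · (P · S_a(k))`
(`currentDiv_window_le_structureFactor` of `AnisotropyChordStiffnessWindow`). [folklore] -/
theorem currentDiv_window_le {ι : Type*} [DecidableEq ι] (s : Finset ι) (Δ : ℝ)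
    (a : TensorIndex (TorusSite 2 L) 2 → ℝ) (E : ℝ)
    (ha : hcbHamiltonian L Δ *ᵥ toC L a = (E : ℂ) • toC L a)
    (v : ι → TensorIndex (TorusSite 2 L) 2 → ℂ) (hv : IsOrthonormalFamily v) (lam : ι → ℝ)
    (heig : ∀ i ∈ s, hcbHamiltonian L Δ *ᵥ v i = ((lam i : ℝ) : ℂ) • v i)
    (Ω : ℝ) (hΩ : 0 ≤ Ω) (hwin : ∀ i ∈ s, E < lam i ∧ lam i ≤ E + Ω)
    (P : ℝ) (hP : P ≠ 0) (k : TorusSite 2 L) :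
    ∑ i ∈ s, ‖star (v i) ⬝ᵥ (currentDiv L Δ k *ᵥ toC L a)‖ ^ 2 / (lam i - E)
      ≤ Ω * (P * structureFactor L a P k) := by
  rw [mul_comm P]
  exact currentDiv_window_le_structureFactor s Δ a E ha v hv lam heig Ω hΩ hwin P hP k

/-! ## Hypothesis (S_Ω) and the proved link to (IR₁) (Sketch8 Part D) -/

/-- **HYPOTHESIS (S_Ω) — `ScaleResolvedStiffness`** (memo ROTOR-THEORY-8 §103; the cycle-8 re-cut of the
infrared input in stiffness currency).  There are `C, Υ₁ > 0` such that, eventually in `L`, for every Perron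
reference amplitude `aM` (sector `M_L − 1`, energy `E`) and every `k ≠ 0` there is an orthonormal family of
eigenvectors of `H` with energies in the window `(E, E + C|k|_T]` — «at the phonon scale» — whose
`1/(λ−E)`-weighted current-divergence weight is at least `Υ₁ |k|_T² P`: a fraction of the kinetic energy
(= the total longitudinal current susceptibility, gauge identity) is carried BELOW energy `C|k|`.
Superfluid (phonon at `ω = c|k|` carries the fraction `ρ_s/t ≈ 0.9–1.0` in ED, kit j297117) vs. Mott /
commensurate solid (weight at the roton / gap scale).  Holds in `d = 1` as well; the dimension enters only
afterwards through `Σ_k 1/S(k)`.  NOT implied by moment data at fixed energy (memo §104 (a)), nor reachable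
variationally without circularity (§104 (c)).
[conjecture: theory seat hubbard-h0-rotor-theory-1, cycle 8, 2026-08-28 — memo ROTOR-THEORY-8 §103 (S_Ω); OPEN] -/
def ScaleResolvedStiffness (Δ : ℝ) (M : ℕ → ℝ) : Prop :=
  ∃ C > (0 : ℝ), ∃ Υ₁ > (0 : ℝ), ∀ᶠ L : ℕ in atTop, ∀ [NeZero L],
    0 < (L : ℝ) ^ 2 / 2 + (M L - 1) ∧
    ∀ aM : TensorIndex (TorusSite 2 L) 2 → ℝ,
      IsPerronSectorGroundAmplitude L Δ (M L - 1) aM →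
        ∀ k : TorusSite 2 L, k ≠ 0 →
          ∃ (m : ℕ) (v : Fin m → TensorIndex (TorusSite 2 L) 2 → ℂ) (lam : Fin m → ℝ),
            IsOrthonormalFamily v ∧
            (∀ i, hcbHamiltonian L Δ *ᵥ v i = ((lam i : ℝ) : ℂ) • v i) ∧
            (∀ i, lowestEnergyInSector 1 (hcbHamiltonian L Δ) (M L - 1) < lam i ∧
                  lam i ≤ lowestEnergyInSector 1 (hcbHamiltonian L Δ) (M L - 1) + C * torusNorm L k) ∧
            Υ₁ * torusNorm L k ^ 2 * ((L : ℝ) ^ 2 / 2 + (M L - 1))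
              ≤ ∑ i, ‖star (v i) ⬝ᵥ (currentDiv L Δ k *ᵥ toC L aM)‖ ^ 2
                    / (lam i - lowestEnergyInSector 1 (hcbHamiltonian L Δ) (M L - 1))

/-- **(S_Ω) ⇒ (IR₁)** (memo ROTOR-THEORY-8 §103): scale-resolved stiffness implies the infrared structure
bound with `α = 1` and `c = Υ₁/C` — `S_L(k) ≥ (Υ₁/C)|k|_T` (THEOREM IR-S + division). [folklore] -/
theorem infraredStructureBound_of_scaleResolvedStiffness (Δ : ℝ) (M : ℕ → ℝ) :
    ScaleResolvedStiffness Δ M → InfraredStructureBound Δ M := by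
  rintro ⟨C, hC, Υ₁, hΥ, hev⟩
  refine ⟨Υ₁ / C, by positivity, 1, by norm_num, ?_⟩
  filter_upwards [hev] with L hL
  intro _inst aM haM k hk
  obtain ⟨hP, hrest⟩ := hL
  obtain ⟨m, v, lam, hv, heig, hwin, hΥ₁⟩ := hrest aM haM k hk
  have hnk := torusNorm_nonneg k
  have hIRS := currentDiv_window_le L Finset.univ Δ aM _ haM.eigen v hv lam
    (fun i _ => heig i) (C * torusNorm L k) (mul_nonneg hC.le hnk) (fun i _ => hwin i) _ hP.ne' k
  have h := le_trans hΥ₁ hIRS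
  have hS := structureFactor_nonneg aM hP.le k
  rw [Real.rpow_one, div_mul_eq_mul_div, div_le_iff₀ hC]
  rcases hnk.eq_or_lt with h0 | hpos
  · rw [← h0, mul_zero]; exact mul_nonneg hS hC.le
  · nlinarith [mul_pos hpos hP, h, hS]

/-! ## The director's (S) and the twist stiffness (S_tw), typed variationally (Sketch8 Part E) -/

/-- **HYPOTHESIS (S) — `UniformTransverseStiffness`** (the director's «uniform transverse stiffness», typed;
memo ROTOR-THEORY-8 §103 (v)).  In helicity-modulus form `Υ^T_L(k) := (⟨−T₂⟩ − 2 m₋₁(J^T_k))/|Λ| ≥ Υ₀ > 0`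
for all axis momenta `k = (q,0) ≠ 0`, eventually in `L` (Scalapino–White–Zhang: the static transverse
current susceptibility falls short of the kinetic energy by `ρ_s`).  Basis-free via the variational
characterisation of `m₋₁`:  `m₋₁(J) ≤ B ⇔ ∀ φ ∈ sector, |⟨φ, Jψ⟩|² ≤ B ⟨φ,(H−E)φ⟩`.  ED (kit j297117, 4×4):
`Υ^T/t ∈ [0.97, 1.00]` for `ρ ≤ ½`, `Δ ∈ [−0.5, 0.9]`.  (S) alone gives only the BORDERLINE bound
`S(k) ≳ ε(k) Υ^T(k)^{3/2}` (THEOREM IR-2, memo §103 (vii): `α = 2`), and (S) + high-energy L/T current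
isotropy gives (S_Ω) (PROP ★, memo §103 (vi)).
[conjecture: theory seat hubbard-h0-rotor-theory-1, cycle 8, 2026-08-28 — memo ROTOR-THEORY-8 §103 (S); hypothesis of H0] -/
def UniformTransverseStiffness (Δ : ℝ) (M : ℕ → ℝ) : Prop :=
  ∃ Υ₀ > (0 : ℝ), ∀ᶠ L : ℕ in atTop, ∀ [NeZero L],
    ∀ aM : TensorIndex (TorusSite 2 L) 2 → ℝ,
      IsPerronSectorGroundAmplitude L Δ (M L - 1) aM →
        ∀ q : ZMod L, q ≠ 0 →
          ∀ φ : TensorIndex (TorusSite 2 L) 2 → ℂ,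
            φ ∈ spinZSector (Λ := TorusSite 2 L) 1 (M L - 1) →
              2 * ‖star φ ⬝ᵥ (currentMode L (Pi.single 0 q) 1 *ᵥ toC L aM)‖ ^ 2
                ≤ ((star (toC L aM) ⬝ᵥ (kineticOp L 1 *ᵥ toC L aM)).re - Υ₀ * (L : ℝ) ^ 2)
                  * (star φ ⬝ᵥ ((hcbHamiltonian L Δ
                        - ((lowestEnergyInSector 1 (hcbHamiltonian L Δ) (M L - 1) : ℝ) : ℂ)
                            • (1 : Op (TorusSite 2 L) 2)) *ᵥ φ)).re

/-- **HYPOTHESIS (S_tw) — `UniformTwistStiffness`**: the same with the UNIFORM current `J¹_0` and `⟨−T₁⟩`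
(`Υ^tw_L |Λ| = ∂²_θ E(θ) = ⟨−T₁⟩ − 2 m₋₁(J¹_0)`, the Drude/twist stiffness; by the gauge identity
`= 2[m₋₁(J¹_k) − m₋₁(J¹_0)]` for every axis `k ≠ 0`, memo §103 (iv)).  ED (kit j297117, 4×4):
`Υ^tw/t ∈ [0.95, 1.00]`.
[conjecture: theory seat hubbard-h0-rotor-theory-1, cycle 8, 2026-08-28 — memo ROTOR-THEORY-8 §103 (S_tw); hypothesis of H0] -/
def UniformTwistStiffness (Δ : ℝ) (M : ℕ → ℝ) : Prop :=
  ∃ Υ₀ > (0 : ℝ), ∀ᶠ L : ℕ in atTop, ∀ [NeZero L],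
    ∀ aM : TensorIndex (TorusSite 2 L) 2 → ℝ,
      IsPerronSectorGroundAmplitude L Δ (M L - 1) aM →
        ∀ φ : TensorIndex (TorusSite 2 L) 2 → ℂ,
          φ ∈ spinZSector (Λ := TorusSite 2 L) 1 (M L - 1) →
            2 * ‖star φ ⬝ᵥ (currentMode L 0 0 *ᵥ toC L aM)‖ ^ 2
              ≤ ((star (toC L aM) ⬝ᵥ (kineticOp L 0 *ᵥ toC L aM)).re - Υ₀ * (L : ℝ) ^ 2)
                * (star φ ⬝ᵥ ((hcbHamiltonian L Δ
                      - ((lowestEnergyInSector 1 (hcbHamiltonian L Δ) (M L - 1) : ℝ) : ℂ)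
                          • (1 : Op (TorusSite 2 L) 2)) *ᵥ φ)).re

/-! ## THEOREM TWIST-IR: (S_Ω^γ), the first lemma L1, the target, and the assembly (Sketch8 Parts F–G) -/

/-- **(S_Ω^γ) — `ScaleResolvedStiffnessExp Δ M γ`**: as `ScaleResolvedStiffness` but with the energy window
`(E, E + C |k|_T^γ]` (real exponent `γ`; `γ = 1` is (S_Ω)).  THEOREM TWIST-IR (memo §107) derives it from
`UniformTwistStiffness` for every `γ < 1`.
[conjecture: theory seat hubbard-h0-rotor-theory-1, cycle 8, 2026-08-28 — memo ROTOR-THEORY-8 §107; THEOREM modulo write-up for γ < 1 given (S_tw)] -/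
def ScaleResolvedStiffnessExp (Δ : ℝ) (M : ℕ → ℝ) (γ : ℝ) : Prop :=
  ∃ C > (0 : ℝ), ∃ Υ₁ > (0 : ℝ), ∀ᶠ L : ℕ in atTop, ∀ [NeZero L],
    0 < (L : ℝ) ^ 2 / 2 + (M L - 1) ∧
    ∀ aM : TensorIndex (TorusSite 2 L) 2 → ℝ,
      IsPerronSectorGroundAmplitude L Δ (M L - 1) aM →
        ∀ k : TorusSite 2 L, k ≠ 0 →
          ∃ (m : ℕ) (v : Fin m → TensorIndex (TorusSite 2 L) 2 → ℂ) (lam : Fin m → ℝ),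
            IsOrthonormalFamily v ∧
            (∀ i, hcbHamiltonian L Δ *ᵥ v i = ((lam i : ℝ) : ℂ) • v i) ∧
            (∀ i, lowestEnergyInSector 1 (hcbHamiltonian L Δ) (M L - 1) < lam i ∧
                  lam i ≤ lowestEnergyInSector 1 (hcbHamiltonian L Δ) (M L - 1)
                            + C * (torusNorm L k) ^ γ) ∧
            Υ₁ * torusNorm L k ^ 2 * ((L : ℝ) ^ 2 / 2 + (M L - 1))
              ≤ ∑ i, ‖star (v i) ⬝ᵥ (currentDiv L Δ k *ᵥ toC L aM)‖ ^ 2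
                    / (lam i - lowestEnergyInSector 1 (hcbHamiltonian L Δ) (M L - 1))

/-- **(S_Ω^γ) ⇒ (IR_{2−γ})** (memo §107 (L5)): scale-resolved stiffness at the scale `C|k|^γ`, `0 < γ < 2`,
gives `InfraredStructureBound` with exponent `α = 2 − γ < 2` and constant `c = Υ₁/C`. [folklore] -/
theorem infraredStructureBound_of_scaleResolvedStiffnessExp (Δ : ℝ) (M : ℕ → ℝ) {γ : ℝ}
    (hγ : 0 < γ) (hγ2 : γ < 2) : ScaleResolvedStiffnessExp Δ M γ → InfraredStructureBound Δ M := by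
  rintro ⟨C, hC, Υ₁, hΥ, hev⟩
  refine ⟨Υ₁ / C, by positivity, 2 - γ, by linarith, ?_⟩
  filter_upwards [hev] with L hL
  intro _inst aM haM k hk
  obtain ⟨hP, hrest⟩ := hL
  obtain ⟨m, v, lam, hv, heig, hwin, hΥ₁⟩ := hrest aM haM k hk
  have hnk := torusNorm_nonneg k
  have hΩ : 0 ≤ C * torusNorm L k ^ γ := mul_nonneg hC.le (Real.rpow_nonneg hnk γ)
  have hIRS := currentDiv_window_le L Finset.univ Δ aM _ haM.eigen v hv lam
    (fun i _ => heig i) (C * torusNorm L k ^ γ) hΩ (fun i _ => hwin i) _ hP.ne' k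
  have h := le_trans hΥ₁ hIRS
  have hS := structureFactor_nonneg aM hP.le k
  rw [div_mul_eq_mul_div, div_le_iff₀ hC]
  rcases hnk.eq_or_lt with h0 | hpos
  · rw [← h0, Real.zero_rpow (by linarith : (2 : ℝ) - γ ≠ 0), mul_zero]
    exact mul_nonneg hS hC.le
  · have hsplit : torusNorm L k ^ (2 - γ) * torusNorm L k ^ γ = torusNorm L k ^ 2 := by
      rw [← Real.rpow_add hpos, sub_add_cancel, Real.rpow_two]
    have hc : 0 < torusNorm L k ^ γ * ((L : ℝ) ^ 2 / 2 + (M L - 1)) :=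
      mul_pos (Real.rpow_pos_of_pos hpos γ) hP
    have h' : Υ₁ * torusNorm L k ^ (2 - γ) * (torusNorm L k ^ γ * ((L : ℝ) ^ 2 / 2 + (M L - 1)))
        ≤ C * structureFactor L aM ((L : ℝ) ^ 2 / 2 + (M L - 1)) k
            * (torusNorm L k ^ γ * ((L : ℝ) ^ 2 / 2 + (M L - 1))) := by
      calc Υ₁ * torusNorm L k ^ (2 - γ) * (torusNorm L k ^ γ * ((L : ℝ) ^ 2 / 2 + (M L - 1)))
          = Υ₁ * (torusNorm L k ^ (2 - γ) * torusNorm L k ^ γ) * ((L : ℝ) ^ 2 / 2 + (M L - 1)) := by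
            ring
        _ = Υ₁ * torusNorm L k ^ 2 * ((L : ℝ) ^ 2 / 2 + (M L - 1)) := by rw [hsplit]
        _ ≤ _ := h
        _ = _ := by ring
    have key := le_of_mul_le_mul_right h' hc
    linarith [key, mul_comm C (structureFactor L aM ((L : ℝ) ^ 2 / 2 + (M L - 1)) k)]

/-- **LEMMA L1 — `FilteredLocalityIdentity`** (the named first lemma of THEOREM TWIST-IR, memo §107; = the
spectral step of Hastings–Koma, CMP 265 (2006) §3 / Nachtergaele–Sims, CMP 265 (2006) §3.2, which the tree
formalises around `commutator_expect_eq_sum`).  Let `Hψ = E₀ψ` and suppose every eigenvector `vᵢ` seen by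
BOTH the `Bψ`- and the `Aψ`-overlap has `λᵢ ≥ E₀` (true for a SECTOR ground state and sector-preserving
`A, B` — no global ground state, no gap).  If `g(ω) = ∫ w(t) e^{itω} dt` with `w` integrable and `g` vanishes
on `(−∞, 0]`, then `Σᵢ g(λᵢ − E₀)⟨ψ, A vᵢ⟩⟨vᵢ, Bψ⟩ = ∫ w(t)⟨ψ, [A, τ_t(B)]ψ⟩ dt`.  With the Lieb–Robinson
bound: high-energy cross-weights of operators at distance `r` are `O((Ωr/v)^{−N})` for ANY eigenstate lowest
in its sector, gapless or not.
[conjecture: theory seat hubbard-h0-rotor-theory-1, cycle 8, 2026-08-28 — memo ROTOR-THEORY-8 §107 lemma L1 (Hastings–Koma §3 filtered spectral identity); to be proved over `commutator_expect_eq_sum`] -/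
def FilteredLocalityIdentity : Prop :=
  ∀ (n : Type) [Fintype n] [DecidableEq n] (H : Matrix n n ℂ) (hH : H.IsHermitian)
    (A B : Matrix n n ℂ) (ψ : n → ℂ) (E₀ : ℝ),
    H *ᵥ ψ = (E₀ : ℂ) • ψ →
    (∀ i, (star ψ ⬝ᵥ (B *ᵥ ⇑(hH.eigenvectorBasis i))) *
            (star (⇑(hH.eigenvectorBasis i)) ⬝ᵥ (A *ᵥ ψ)) ≠ 0 → E₀ ≤ hH.eigenvalues i) →
    ∀ (w : ℝ → ℂ), Integrable w →
    ∀ (g : ℝ → ℂ), (∀ ω : ℝ, g ω = ∫ t : ℝ, w t * cexp (((t * ω : ℝ) : ℂ) * I)) →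
      (∀ ω : ℝ, ω ≤ 0 → g ω = 0) →
        ∑ i, g (hH.eigenvalues i - E₀) *
            ((star ψ ⬝ᵥ (A *ᵥ ⇑(hH.eigenvectorBasis i))) *
              (star (⇑(hH.eigenvectorBasis i)) ⬝ᵥ (B *ᵥ ψ)))
          = ∫ t : ℝ, w t *
              (star ψ ⬝ᵥ ((A * heisenbergEvolution H t B - heisenbergEvolution H t B * A) *ᵥ ψ))

/-- **THEOREM TWIST-IR (memo ROTOR-THEORY-8 §107) — typed target.**  For hard-core bosons / XXZ on the 2D
torus with `Δ > −1` (Perron sectors): uniform twist stiffness implies scale-resolved stiffness at the scale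
`C|k|^γ` for some `γ ∈ (0,1]` (the memo proves every `γ < 1`), hence `InfraredStructureBound`.  Proof chain
(memo §107): L1 `FilteredLocalityIdentity` + Lieb–Robinson (tree) ⇒ L2 far-field decay of the filtered
current kernel; L3 gauge identity at every axis momentum + diamagnetic bound and the jump
`K̂(0) = (t − Υ^tw)/2`; L4 Parseval on `ℤ_L` (near field); L5 choice `Ω = C|k|^γ`, THEOREM IR-S.
STATUS: proof sketch at memo level; not refereed; formal proof = target for the prover seat.
[conjecture: theory seat hubbard-h0-rotor-theory-1, cycle 8, 2026-08-28 — memo ROTOR-THEORY-8 §107; claimed THEOREM, proof sketch] -/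
def TwistStiffnessInfrared : Prop :=
  ∀ (Δ : ℝ) (M : ℕ → ℝ), -1 < Δ → UniformTwistStiffness Δ M →
    ∃ γ : ℝ, 0 < γ ∧ γ ≤ 1 ∧ ScaleResolvedStiffnessExp Δ M γ

/-- **(S_tw) ⇒ (IR_α)** for some `α < 2`, GIVEN THEOREM TWIST-IR. [folklore] -/
theorem infraredStructureBound_of_uniformTwistStiffness (hT : TwistStiffnessInfrared) (Δ : ℝ)
    (M : ℕ → ℝ) (hΔ : -1 < Δ) (hS : UniformTwistStiffness Δ M) : InfraredStructureBound Δ M := by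
  obtain ⟨γ, hγ, hγ1, h⟩ := hT Δ M hΔ hS
  exact infraredStructureBound_of_scaleResolvedStiffnessExp Δ M hγ (by linarith) h

/-- **H0 IN THE ROTOR CLASS, ASSEMBLED (memo ROTOR-THEORY-8 §107, Sketch8 Part G).**  GIVEN THEOREM TWIST-IR:
along a sector sequence of density `1/2 + M_L/L² → ρ ∈ (0,1)` with eventually non-trivial reference sectors,
UNIFORM TWIST STIFFNESS + the one-body insertion structure H1 + the no-Bragg-peak bound imply Bose–Einstein
condensation (`EventualCondensate`) of the Perron sector ground states of the XXZ / hard-core boson torus,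
`Δ > −1` — via `infraredStructureBound_of_uniformTwistStiffness` and the entropy route's end-to-end
reduction `eventualCondensate_of_onebody_infrared`.  Compressibility is no longer a hypothesis.  Open
physics after cycle 8: H1 (`OneBodyInsertionStructure`) and the formal proof of `TwistStiffnessInfrared`. [folklore] -/
theorem eventualCondensate_of_uniformTwistStiffness (hT : TwistStiffnessInfrared) (Δ : ℝ) (M : ℕ → ℝ)
    (ρ : ℝ) (hΔ : -1 < Δ) (hρ : ρ ∈ Set.Ioo (0 : ℝ) 1)
    (hlim : Tendsto (fun L : ℕ => 1 / 2 + M L / (L : ℝ) ^ 2) atTop (𝓝 ρ))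
    (hsect : ∀ᶠ L : ℕ in atTop, ∀ [NeZero L], spinZSector (Λ := TorusSite 2 L) 1 (M L - 1) ≠ ⊥)
    (h1 : OneBodyInsertionStructure Δ M) (hS : UniformTwistStiffness Δ M)
    (hSmax : StructureFactorUpper Δ M) : EventualCondensate Δ M :=
  eventualCondensate_of_onebody_infrared Δ M ρ hρ hlim hsect h1
    (infraredStructureBound_of_uniformTwistStiffness hT Δ M hΔ hS) hSmax

end Summit.HubbardSuperconductivity.HubbardSuperconductivity.Theorems.AnisotropyChord.Stiffness
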